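import Mathlib
import HarnessLib
import Summits.Parity.GeneralizedHardyLittlewood.Theses.LiouvilleMAD

/-!
# Strategy census for `FanDecorrelation` (stmt-Parity-13318) — typed statements

Companion of `STRATEGY-CENSUS.md` (crux-strategist, unit `cstrat-stmt-Parity-13318-p1`, 2026-08-17).
Every statement the census names as an S⁺ / sub-crux / normal-form face is TYPED here over existing
declarations (nothing is claimed proved except the three glue one-liners at the end, which are).

* `SecondOrderChowla` — the crux's pure-Liouville `k = 1` core (its model instance `(c,n,n') = (2,1,2)`,
  `modelCase_holds` of `Cruxes/FanDecorrelation/SketchIdeator1.lean`): the STUCK GOAL of the whole chain.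
* `SqrtAffineChowla₂` — STRENGTHEN S1: square-root cancellation for two non-proportional affine-linear forms in
  two variables over boxes (the natural random-model parent; contains the crux as the instance
  `(m, j) ↦ (nm + c, n'm − n'kj + c)` on `(M,2M] × [Q,2Q)`).
* `LaggedBlockCovarianceLaw` — STRENGTHEN S2 / DECOMPOSITION D3: power-saving law for lagged covariances of short
  block sums of the two dilated Liouville rows (Good–Churchhouse-type second-order law); by the discrete Fejér
  synthesis `Φ((h−P)/D) = Σ_L Δ²Φ · (L − |h−·|)_+` it is EQUIVALENT in kind to the smooth wide law `stub_wideLaw`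
  of line SketchIdeator5 — recorded to correct the belief "variance input loses the factor Q" (it loses `Q/D`,
  nothing for `D ≍ Q`).
* `FanSmallConductor η` / `FanLargeDilations η` — DECOMPOSITION D2 (PLANNER-NOTE-ideator4 §3; route TWO-LAYER PLAN):
  the crux split by the size of `n·n'` against `M^η`; glue `fan_of_small_large` PROVED (case split).
* `closes_of_dilatedChowla` — THE DOOR: the route's deciding theorem needs `FanDecorrelation` only to produce the
  rank-4 crux `DilatedChowla`; PROVED here that `DilatedChowla → ElliottHalberstam → EngineToGHL → GHL` with the
  route's own items (pure logic), i.e. re-gluing `closes` on `DilatedChowla` makes 13317/13318 optional support.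
-/

noncomputable section

namespace Summit.Parity.GeneralizedHardyLittlewood.Cruxes.FanDecorrelation.StrategyCensus

open Finset
open Summit.Parity.GeneralizedHardyLittlewood.Theses.LiouvilleMAD

/-! ## The stuck goal: second-order Chowla (pure Liouville, `k = 1` core of the crux) -/

/-- `SecondOrderChowla`: for some `ϑ < 1/4` and `C`, for all `M` and all `k ≠ 0`:
`|Σ_{j∈[Q,2Q)} Σ_{m∈(M,2M], m−kj∈(M,2M]} λ(m+2) λ(m−kj+1)| ≤ C·M^{3/4+ϑ}`, `Q = ⌊√M⌋+1` — the crux at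
`(c,n,n') = (2,1,2)` up to the sign `λ(2x) = −λ(x)` (`modelCase_holds`).  Necessary for the crux; a signed
power saving among `√M` consecutive two-point Liouville autocorrelations (beyond GRH and beyond pointwise
square-root Chowla, which give only the Parseval wall `M^{1+o(1)}`). -/
def SecondOrderChowla : Prop :=
  ∃ ϑ : ℝ, ϑ < 1 / 4 ∧ ∃ C : ℝ, ∀ M : ℕ, ∀ k : ℤ, k ≠ 0 →
    |∑ j ∈ Ico (Nat.sqrt M + 1) (2 * (Nat.sqrt M + 1)),
        ∑ p ∈ (Ioc M (2 * M) ×ˢ Ioc M (2 * M)).filter (fun p : ℕ × ℕ => (p.1 : ℤ) - p.2 = k * (j : ℤ)),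
          (ArithmeticFunction.liouville (p.1 + 2) : ℝ) * (ArithmeticFunction.liouville (p.2 + 1) : ℝ)| ≤
      C * (M : ℝ) ^ (3 / 4 + ϑ)

/-! ## STRENGTHEN S1: square-root Chowla for two affine forms in two variables -/

/-- `SqrtAffineChowla₂`: for every `ε > 0` and `A` there is `C` such that for all `N ≥ 1`, all boxes
`(x₀, x₀+X] × (y₀, y₀+Y]` with `X, Y ≤ N`, `|x₀|, |y₀| ≤ N^A`, and all pairs of affine forms
`ψ_i(x,y) = a_i x + b_i y + c_i` with `|a_i|,|b_i|,|c_i| ≤ N^A`, NON-PROPORTIONAL linear parts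
(`a₁b₂ ≠ a₂b₁`) and positive values on the box:
`|Σ_{(x,y) ∈ box} λ(ψ₁(x,y)) λ(ψ₂(x,y))| ≤ C · (XY)^{1/2} · N^{ε}`.
Implies the crux (box `(M,2M] × [Q,2Q)` in the variables `(m, j)`, forms `nm + c`, `n'm − n'kj + c`, after the
harmless triangle cut `m − kj ∈ (M,2M]`), with `ϑ = ε`; strictly stronger than square-root two-point Chowla
(`Y = 1` is excluded by nothing but gives only the trivial bound there — the content is the JOINT square root). -/
def SqrtAffineChowla₂ : Prop :=
  ∀ ε : ℝ, 0 < ε → ∀ A : ℝ, ∃ C : ℝ, ∀ N X Y : ℕ, 1 ≤ N → X ≤ N → Y ≤ N →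
    ∀ x₀ y₀ a₁ b₁ c₁ a₂ b₂ c₂ : ℤ,
      |x₀| ≤ (N : ℝ) ^ A → |y₀| ≤ (N : ℝ) ^ A →
      |a₁| ≤ (N : ℝ) ^ A → |b₁| ≤ (N : ℝ) ^ A → |c₁| ≤ (N : ℝ) ^ A →
      |a₂| ≤ (N : ℝ) ^ A → |b₂| ≤ (N : ℝ) ^ A → |c₂| ≤ (N : ℝ) ^ A →
      a₁ * b₂ ≠ a₂ * b₁ →
      (∀ x ∈ Ioc x₀ (x₀ + X), ∀ y ∈ Ioc y₀ (y₀ + Y), 0 < a₁ * x + b₁ * y + c₁ ∧ 0 < a₂ * x + b₂ * y + c₂) →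
        |∑ x ∈ Ioc x₀ (x₀ + X), ∑ y ∈ Ioc y₀ (y₀ + Y),
            (ArithmeticFunction.liouville (Int.toNat (a₁ * x + b₁ * y + c₁)) : ℝ) *
              (ArithmeticFunction.liouville (Int.toNat (a₂ * x + b₂ * y + c₂)) : ℝ)| ≤
          C * Real.sqrt ((X : ℝ) * Y) * (N : ℝ) ^ ε

/-! ## STRENGTHEN S2 / DECOMPOSITION D3: lagged block covariance law (Good–Churchhouse type) -/

/-- Block sum of the row `m ↦ λ(mn+c)` over `(x, x+L] ∩ (M,2M]`. -/
def blockSum (c : ℤ) (n M L : ℕ) (x : ℤ) : ℝ :=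
  ∑ m ∈ (Ioc M (2 * M)).filter (fun m : ℕ => x < (m : ℤ) ∧ (m : ℤ) ≤ x + L),
    (ArithmeticFunction.liouville (Int.toNat ((m : ℤ) * n + c)) : ℝ)

/-- `LaggedBlockCovarianceLaw`: for every `c ≠ 0` and `δ > 0` there are `κ > 0`, `C` such that for all `M`,
`1 ≤ n ≠ n' ≤ 2M`, block lengths `L` and lags `s` with `M^δ ≤ L`, `4L ≤ s ≤ 4Q` (`Q = ⌊√M⌋+1`; so every lag in the
tent `(s−L, s+L)` is `≥ 3M^δ`):
`|Σ_{x ∈ [M−L, 2M]} blockSum(n; x) · blockSum(n'; x − s)| ≤ C · L · M^{1−κ}`.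
The sum is the tent-weighted fan `Σ_h (L − |h − s|)_+ · Σ_m λ(mn+c)λ((m−h)n'+c)`; smooth windows of width `D` at
position `P` are superpositions of such tents with `L ≍ D`, coefficient mass `O(D/L²)`, so this law with `L ≍ D`
gives the smooth fan bound `O((D/L)·M^{1−κ})` with NO loss — and conversely it is a smooth-fan statement itself:
the same second-order content as `stub_wideLaw` (SketchIdeator5), in variance coordinates. -/
def LaggedBlockCovarianceLaw : Prop :=
  ∀ c : ℤ, c ≠ 0 → ∀ δ : ℝ, 0 < δ → ∃ κ : ℝ, 0 < κ ∧ ∃ C : ℝ, ∀ M n n' L s : ℕ,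
    1 ≤ n → 1 ≤ n' → n ≠ n' → n ≤ 2 * M → n' ≤ 2 * M →
    (M : ℝ) ^ δ ≤ L → 4 * L ≤ s → s ≤ 4 * (Nat.sqrt M + 1) →
      |∑ x ∈ Icc ((M : ℤ) - L) (2 * M), blockSum c n M L x * blockSum c n' M L (x - s)| ≤
        C * L * (M : ℝ) ^ (1 - κ)

/-! ## DECOMPOSITION D2: split by conductor size -/

/-- The fan sum of the crux (verbatim inner expression of `FanDecorrelation`). -/
def fanSum (c : ℤ) (n n' M : ℕ) (k : ℤ) : ℝ :=
  ∑ j ∈ Ico (Nat.sqrt M + 1) (2 * (Nat.sqrt M + 1)),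
    ∑ p ∈ (Ioc M (2 * M) ×ˢ Ioc M (2 * M)).filter (fun p : ℕ × ℕ => (p.1 : ℤ) - p.2 = k * (j : ℤ)),
      (ArithmeticFunction.liouville (Int.toNat ((p.1 : ℤ) * n + c)) : ℝ) *
        (ArithmeticFunction.liouville (Int.toNat ((p.2 : ℤ) * n' + c)) : ℝ)

theorem fanDecorrelation_iff_fanSum :
    FanDecorrelation ↔ ∀ c : ℤ, c ≠ 0 → ∃ ϑ : ℝ, ϑ < 1 / 4 ∧ ∃ C : ℝ, ∀ M n n' : ℕ, ∀ k : ℤ,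
      1 ≤ n → 1 ≤ n' → n ≠ n' → n ≤ 2 * M → n' ≤ 2 * M → k ≠ 0 →
        |fanSum c n n' M k| ≤ C * (M : ℝ) ^ (3 / 4 + ϑ) := Iff.rfl

/-- `FanSmallConductor η`: the crux restricted to dilation pairs with `n·n' ≤ M^η` (the "small-conductor" half:
rows are λ on APs of modulus `≤ M^η`; the half where a zero-side dictionary exists, PLANNER-NOTE-ideator4 §1). -/
def FanSmallConductor (η : ℝ) : Prop :=
  ∀ c : ℤ, c ≠ 0 → ∃ ϑ : ℝ, ϑ < 1 / 4 ∧ ∃ C : ℝ, ∀ M n n' : ℕ, ∀ k : ℤ,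
    1 ≤ n → 1 ≤ n' → n ≠ n' → n ≤ 2 * M → n' ≤ 2 * M → k ≠ 0 → ((n : ℝ) * n' ≤ (M : ℝ) ^ η) →
      |fanSum c n n' M k| ≤ C * (M : ℝ) ^ (3 / 4 + ϑ)

/-- `FanLargeDilations η`: the crux restricted to dilation pairs with `n·n' > M^η` (rows are λ on APs whose
modulus exceeds `M^η`; for `η ≥ 1` no known theory bounds even the one-point row sums — "where GRH is silent"). -/
def FanLargeDilations (η : ℝ) : Prop :=
  ∀ c : ℤ, c ≠ 0 → ∃ ϑ : ℝ, ϑ < 1 / 4 ∧ ∃ C : ℝ, ∀ M n n' : ℕ, ∀ k : ℤ,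
    1 ≤ n → 1 ≤ n' → n ≠ n' → n ≤ 2 * M → n' ≤ 2 * M → k ≠ 0 → ((M : ℝ) ^ η < (n : ℝ) * n') →
      |fanSum c n n' M k| ≤ C * (M : ℝ) ^ (3 / 4 + ϑ)

/-- Glue of D2 (PROVED): the two halves give the crux (larger `ϑ`, sum of constants). -/
theorem fan_of_small_large (η : ℝ) (h₁ : FanSmallConductor η) (h₂ : FanLargeDilations η) :
    FanDecorrelation := by
  rw [fanDecorrelation_iff_fanSum]
  intro c hc
  obtain ⟨ϑ₁, hϑ₁, C₁, hC₁⟩ := h₁ c hc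
  obtain ⟨ϑ₂, hϑ₂, C₂, hC₂⟩ := h₂ c hc
  refine ⟨max ϑ₁ ϑ₂, max_lt hϑ₁ hϑ₂, max C₁ 0 + max C₂ 0, ?_⟩
  intro M n n' k hn hn' hnn' hnM hn'M hk
  have hM1 : 1 ≤ M := by omega
  have hMr : (1 : ℝ) ≤ M := by exact_mod_cast hM1
  have hpow₁ : (M : ℝ) ^ (3 / 4 + ϑ₁) ≤ (M : ℝ) ^ (3 / 4 + max ϑ₁ ϑ₂) :=
    Real.rpow_le_rpow_of_exponent_le hMr (by linarith [le_max_left ϑ₁ ϑ₂])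
  have hpow₂ : (M : ℝ) ^ (3 / 4 + ϑ₂) ≤ (M : ℝ) ^ (3 / 4 + max ϑ₁ ϑ₂) :=
    Real.rpow_le_rpow_of_exponent_le hMr (by linarith [le_max_right ϑ₁ ϑ₂])
  have hP0 : 0 ≤ (M : ℝ) ^ (3 / 4 + max ϑ₁ ϑ₂) := Real.rpow_nonneg (by positivity) _
  have hP1 : 0 ≤ (M : ℝ) ^ (3 / 4 + ϑ₁) := Real.rpow_nonneg (by positivity) _
  have hP2 : 0 ≤ (M : ℝ) ^ (3 / 4 + ϑ₂) := Real.rpow_nonneg (by positivity) _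
  by_cases hsmall : (n : ℝ) * n' ≤ (M : ℝ) ^ η
  · have h := hC₁ M n n' k hn hn' hnn' hnM hn'M hk hsmall
    calc |fanSum c n n' M k| ≤ C₁ * (M : ℝ) ^ (3 / 4 + ϑ₁) := h
      _ ≤ max C₁ 0 * (M : ℝ) ^ (3 / 4 + ϑ₁) := mul_le_mul_of_nonneg_right (le_max_left _ _) hP1
      _ ≤ max C₁ 0 * (M : ℝ) ^ (3 / 4 + max ϑ₁ ϑ₂) := mul_le_mul_of_nonneg_left hpow₁ (le_max_right _ _)
      _ ≤ (max C₁ 0 + max C₂ 0) * (M : ℝ) ^ (3 / 4 + max ϑ₁ ϑ₂) := by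
          have : 0 ≤ max C₂ 0 * (M : ℝ) ^ (3 / 4 + max ϑ₁ ϑ₂) := mul_nonneg (le_max_right _ _) hP0
          nlinarith
  · push Not at hsmall
    have h := hC₂ M n n' k hn hn' hnn' hnM hn'M hk hsmall
    calc |fanSum c n n' M k| ≤ C₂ * (M : ℝ) ^ (3 / 4 + ϑ₂) := h
      _ ≤ max C₂ 0 * (M : ℝ) ^ (3 / 4 + ϑ₂) := mul_le_mul_of_nonneg_right (le_max_left _ _) hP2
      _ ≤ max C₂ 0 * (M : ℝ) ^ (3 / 4 + max ϑ₁ ϑ₂) := mul_le_mul_of_nonneg_left hpow₂ (le_max_right _ _)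
      _ ≤ (max C₁ 0 + max C₂ 0) * (M : ℝ) ^ (3 / 4 + max ϑ₁ ϑ₂) := by
          have : 0 ≤ max C₁ 0 * (M : ℝ) ^ (3 / 4 + max ϑ₁ ϑ₂) := mul_nonneg (le_max_right _ _) hP0
          nlinarith

/-- Conversely the crux gives both halves (so D2 is a genuine partition, not a weakening). -/
theorem small_large_of_fan (η : ℝ) (h : FanDecorrelation) :
    FanSmallConductor η ∧ FanLargeDilations η := by
  rw [fanDecorrelation_iff_fanSum] at h
  constructor
  · intro c hc
    obtain ⟨ϑ, hϑ, C, hC⟩ := h c hc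
    exact ⟨ϑ, hϑ, C, fun M n n' k hn hn' hnn' hnM hn'M hk _ => hC M n n' k hn hn' hnn' hnM hn'M hk⟩
  · intro c hc
    obtain ⟨ϑ, hϑ, C, hC⟩ := h c hc
    exact ⟨ϑ, hϑ, C, fun M n n' k hn hn' hnn' hnM hn'M hk _ => hC M n n' k hn hn' hnn' hnM hn'M hk⟩

/-! ## THE DOOR: the route closes on `DilatedChowla` without the decorrelation cruxes -/

/-- PROVED (pure logic, the route's own items): the deciding theorem of LiouvilleMAD needs `CosetDecorrelation`
and `FanDecorrelation` ONLY to produce `DilatedChowla` (`hX.1 h₁ h₂`).  With `DilatedChowla` (rank-4 crux,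
stmt-Parity-13319) as a hypothesis the same term closes the sub-problem. -/
theorem closes_of_dilatedChowla (hD : DilatedChowla) (hEH : ElliottHalberstam) (hX : EngineToGHL) :
    _root_.GeneralizedHardyLittlewood :=
  hX.2.2.2.2 (hX.2.2.2.1 (hX.2.2.1 (hX.2.1 hD)) hEH)

/-- The same, keeping only conjuncts 2–5 of `EngineToGHL` (what a re-glued route would carry; `PairsHL` is the
route's inlined fixed-shift Hardy–Littlewood statement, kept abstract here). -/
theorem closes_of_dilatedChowla' {PairsHL : Prop} (hD : DilatedChowla) (hEH : ElliottHalberstam)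
    (h2 : DilatedChowla → TypeIILiouville) (h3 : TypeIILiouville → LambdaLiouvilleLevel)
    (h4 : LambdaLiouvilleLevel → ElliottHalberstam → PairsHL)
    (h5 : PairsHL → _root_.GeneralizedHardyLittlewood) :
    _root_.GeneralizedHardyLittlewood :=
  h5 (h4 (h3 (h2 hD)) hEH)

end Summit.Parity.GeneralizedHardyLittlewood.Cruxes.FanDecorrelation.StrategyCensus

end
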